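import Summits.BirchSwinnertonDyer.BirchSwinnertonDyer.Theses.SemiOrdinaryEisensteinDescent
import Literature.NumberTheory.EllipticCurves.BSDHeegnerPointsGrossZagierProofs
import Literature.NumberTheory.EllipticCurves.BSDSelmerCMPConverseRankOneProofs
import HarnessLib

/-!
# Negative-lane lemmas for crux J‴ `SemiOrdinaryEisensteinDescent.WildSigmaDivisibilityAtThreeMultiCarrier`
# (stmt-BirchSwinnertonDyer-25898), part (D): the binders `L(E^{d_K},1) ≠ 0` (h₇) and `¬ IsOfFinAddOrder P` (h₉)
# DUPLICATE each other at analytic rank one — J‴ with either one deleted follows from J‴ modulo two print facts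

Refuter vet file (tk5j gen 14, 2026-08-28; `--supports` stmt-BirchSwinnertonDyer-25898, helper). Nothing here refutes the crux,
which stays OPEN research, and nothing here asserts any route statement positively (J‴ is a HYPOTHESIS of §D2); BSD is not proved
by anything here. Sorry-free, standard axioms. The two print inputs are displayed hypotheses BY NAME: `gross_zagier N W K`
(Gross–Zagier 1986, Thm. I.(6.3) with V.§2, as the tree's `GrossZagierFormula`: `L′(E/K,1) = const · ĥ(P)` with `const > 0`) and
`hasEntireLFunction_rat` (modularity ⇒ `L(E′,s)` entire for every elliptic `E′/ℚ`; used only for differentiability at `s = 1` of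
the two factors of `LDerivEK W K = deriv (s ↦ L(E,s)·L(E^{d_K},s)) 1`).

* §D1 `twistL_one_ne_zero_of_nonTorsion` / `nonTorsion_of_twistL_one_ne_zero`: on a frame with `ord_{s=1} L(E,s) = 1`, `K`
  imaginary quadratic and Heegner for `N`, `P ↦ y` the Heegner point: **`L(E^{d_K},1) ≠ 0 ⟺ P` has infinite order** (modulo the two
  facts). Mechanism: `L(E,1) = 0` and `L′(E,1) ≠ 0` at analytic rank one
  (`entireLFunction_one_eq_zero_and_deriv_ne_zero_of_analyticRank_eq_one`), so by the product rule
  `L′(E/K,1) = L′(E,1)·L(E^{d_K},1)`; and `L′(E/K,1) ≠ 0 ⟺ P` non-torsion is `lDerivEK_ne_zero_iff_not_isOfFinAddOrder` (Gross–Zagier).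
* §D2 `noTwistL_of_wildSigmaDivisibilityAtThreeMultiCarrier` / `noNonTorsion_of_wildSigmaDivisibilityAtThreeMultiCarrier`:
  **J‴ ⟹ J‴'s text with h₇ deleted**, and **J‴ ⟹ J‴'s text with h₉ deleted** (everything else verbatim). Reading for the prover:
  exactly ONE of h₇/h₉ is decoration; deleting BOTH is a different statement (it admits frames with `ord_{s=1} L(E/K,s) = 3` and
  torsion `y_K`) and is not addressed here. (The converse implications are trivial weakenings and conclude J‴, hence are not stated
  on this lane.) [cite: GrossZagier1986, Thm. I.(6.3) and V.§2] [cite: IrelandRosen1990, Prop. 20.5.4(b)] [folklore]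
-/

-- single-conjunct summit: `Summit.BirchSwinnertonDyer.BirchSwinnertonDyer.…` repeats the name by design (tree layout D-0017)
set_option linter.dupNamespace false
set_option autoImplicit false

open scoped Classical

namespace Summit.BirchSwinnertonDyer.BirchSwinnertonDyer.Theorems.WildSigmaDivisibilityAtThreeMultiCarrier.Negative

open WeierstrassCurve NumberField
  Literature.NumberTheory.EllipticCurves
  Literature.NumberTheory.EllipticCurves.ModularForms
  Summit.BirchSwinnertonDyer.Rank1Residual
  Summit.BirchSwinnertonDyer.Rank1Residual.Additive
  Summit.BirchSwinnertonDyer.Rank1Residual.X11b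
  Summit.BirchSwinnertonDyer.Rank1Residual.X11b.Three
  Summit.BirchSwinnertonDyer.BirchSwinnertonDyer.Theses.SemiOrdinaryEisensteinDescent

/-! ## §D1 At analytic rank one on a Heegner frame: `L(E^{d_K},1) ≠ 0 ⟺ P` non-torsion (modulo Gross–Zagier + modularity) -/

/-- **`r_an(E) = 1` ∧ `P` non-torsion ⟹ `L(E^{d_K},1) ≠ 0`** (modulo `gross_zagier`, `hasEntireLFunction_rat`). Since `L(E,1) = 0`,
the product rule gives `L′(E/K,1) = L′(E,1)·L(E^{d_K},1)`; if `L(E^{d_K},1) = 0` then `L′(E/K,1) = 0`, contradicting Gross–Zagier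
for the non-torsion Heegner point `P`. [cite: GrossZagier1986, Thm. I.(6.3) and V.§2] [cite: IrelandRosen1990, Prop. 20.5.4(b)] -/
theorem twistL_one_ne_zero_of_nonTorsion {W : WeierstrassCurve ℚ} [W.IsElliptic] {N : ℕ} [NeZero N] {K : Type} [Field K]
    [NumberField K] (hGZ : gross_zagier N W K) (hmod : hasEntireLFunction_rat)
    (Dt : ModularParametrizationData W N) (H : HeegnerDatum N (NumberField.discr K)) (ι : K →+* ℂ)
    (P : (W.baseChange K).toAffine.Point) (hr : W.analyticRank = 1) (hK : IsImaginaryQuadratic K)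
    (hHH : SatisfiesHeegnerHypothesis N K)
    (hP : WeierstrassCurve.Affine.Point.map ι.toRatAlgHom P = heegnerPointComplex Dt H) (hnt : ¬ IsOfFinAddOrder P) :
    (W.quadraticTwist (NumberField.discr K : ℚ)).entireLFunction 1 ≠ 0 := by
  intro hLd
  have hHP : IsHeegnerPoint N W K P := ⟨Dt, H, ι, hP⟩
  have hne : LDerivEK W K ≠ 0 := (lDerivEK_ne_zero_iff_not_isOfFinAddOrder W N K hGZ hK hHH hHP).mpr hnt
  have hd : (NumberField.discr K : ℚ) ≠ 0 := by exact_mod_cast NumberField.discr_ne_zero K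
  haveI := W.isElliptic_quadraticTwist hd
  have hf : DifferentiableAt ℂ W.entireLFunction 1 := (W.differentiable_entireLFunction (hmod W)) 1
  have hg : DifferentiableAt ℂ (W.quadraticTwist (NumberField.discr K : ℚ)).entireLFunction 1 :=
    ((W.quadraticTwist _).differentiable_entireLFunction (hmod _)) 1
  have h0 : W.entireLFunction 1 = 0 := (entireLFunction_one_eq_zero_and_deriv_ne_zero_of_analyticRank_eq_one W hr).1
  apply hne
  unfold LDerivEK
  rw [deriv_fun_mul hf hg, h0, hLd]
  simp

/-- **`r_an(E) = 1` ∧ `L(E^{d_K},1) ≠ 0 ⟹ P` non-torsion** (modulo `gross_zagier`, `hasEntireLFunction_rat`): `L′(E,1) ≠ 0` at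
analytic rank one, so `L′(E/K,1) = L′(E,1)·L(E^{d_K},1) ≠ 0`, and Gross–Zagier makes the Heegner point `P` non-torsion.
[cite: GrossZagier1986, Thm. I.(6.3) and V.§2] [cite: IrelandRosen1990, Prop. 20.5.4(b)] -/
theorem nonTorsion_of_twistL_one_ne_zero {W : WeierstrassCurve ℚ} [W.IsElliptic] {N : ℕ} [NeZero N] {K : Type} [Field K]
    [NumberField K] (hGZ : gross_zagier N W K) (hmod : hasEntireLFunction_rat)
    (Dt : ModularParametrizationData W N) (H : HeegnerDatum N (NumberField.discr K)) (ι : K →+* ℂ)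
    (P : (W.baseChange K).toAffine.Point) (hr : W.analyticRank = 1) (hK : IsImaginaryQuadratic K)
    (hHH : SatisfiesHeegnerHypothesis N K)
    (hP : WeierstrassCurve.Affine.Point.map ι.toRatAlgHom P = heegnerPointComplex Dt H)
    (hLd : (W.quadraticTwist (NumberField.discr K : ℚ)).entireLFunction 1 ≠ 0) : ¬ IsOfFinAddOrder P := by
  have hHP : IsHeegnerPoint N W K P := ⟨Dt, H, ι, hP⟩
  refine (lDerivEK_ne_zero_iff_not_isOfFinAddOrder W N K hGZ hK hHH hHP).mp ?_
  have hd : (NumberField.discr K : ℚ) ≠ 0 := by exact_mod_cast NumberField.discr_ne_zero K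
  haveI := W.isElliptic_quadraticTwist hd
  have hf : DifferentiableAt ℂ W.entireLFunction 1 := (W.differentiable_entireLFunction (hmod W)) 1
  have hg : DifferentiableAt ℂ (W.quadraticTwist (NumberField.discr K : ℚ)).entireLFunction 1 :=
    ((W.quadraticTwist _).differentiable_entireLFunction (hmod _)) 1
  obtain ⟨h0, hder⟩ := entireLFunction_one_eq_zero_and_deriv_ne_zero_of_analyticRank_eq_one W hr
  unfold LDerivEK
  rw [deriv_fun_mul hf hg, h0, zero_mul, add_zero]
  exact mul_ne_zero hder hLd

/-! ## §D2 J‴ ⟹ J‴ with h₇ deleted, and J‴ ⟹ J‴ with h₉ deleted (modulo the two facts) -/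

/-- **J‴ ⟹ J‴'s text WITHOUT the binder `L(E^{d_K},1) ≠ 0`** (everything else verbatim), modulo {Gross–Zagier, modularity}: the
missing binder is re-supplied by `twistL_one_ne_zero_of_nonTorsion`. Information for the prover (h₇ is decoration given h₃ ∧ h₉);
no change of meaning. [folklore] -/
theorem noTwistL_of_wildSigmaDivisibilityAtThreeMultiCarrier
    (hGZ : ∀ (N : ℕ) [NeZero N] (W : WeierstrassCurve ℚ) (K : Type) [Field K] [NumberField K], gross_zagier N W K)
    (hmod : hasEntireLFunction_rat) (hJ : WildSigmaDivisibilityAtThreeMultiCarrier) :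
    ∀ (W : WeierstrassCurve ℚ) [W.IsElliptic] [W.IsGloballyMinimal] (N : ℕ) [NeZero N] (K : Type)
      [Field K] [NumberField K] (Dt : ModularParametrizationData W N)
      (H : HeegnerDatum N (NumberField.discr K)) (ι : K →+* ℂ) (P : (W.baseChange K).toAffine.Point),
      ClassO6 W 3 → W.HasSurjectiveModNGaloisRep 3 → W.analyticRank = 1 → W.conductorNorm ℤ = N →
      IsImaginaryQuadratic K → SatisfiesHeegnerHypothesis N K →
      WeierstrassCurve.Affine.Point.map ι.toRatAlgHom P = heegnerPointComplex Dt H →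
      ¬ IsOfFinAddOrder P → Odd (NumberField.discr K) → NumberField.discr K ≠ -3 →
      (∀ (q : ℕ) [Fact q.Prime], q ∣ N →
        padicValNat 3 ((W.baseChange ℚ_[q]).localTamagawaNumber ℤ_[q]) <
          padicValNat 3 W.tamagawaProduct + padicValNat 3 Dt.c.natAbs) →
      ∀ (s' : ℕ), s' ≤ padicValNat 3 W.tamagawaProduct + padicValNat 3 Dt.c.natAbs →
        ∀ (n : ℕ) (d : KolyvaginHeegnerData Dt H.β ι n), Squarefree n →
          (∀ ℓ ∈ n.primeFactors, Zhang2014.IsKolyvaginPrime N W K 3 ℓ ∧ s' ≤ Zhang2014.kolyvaginIndex W 3 ℓ) →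
          Koly.PDiv d 3 s' := by
  intro W _ _ N _ K _ _ Dt H ι P hO6 hsurj hr hN hK hHH hP hnt hodd h3 hcut
  exact hJ W N K Dt H ι P hO6 hsurj hr hN hK hHH
    (twistL_one_ne_zero_of_nonTorsion (hGZ N W K) hmod Dt H ι P hr hK hHH hP hnt) hP hnt hodd h3 hcut

/-- **J‴ ⟹ J‴'s text WITHOUT the binder `¬ IsOfFinAddOrder P`** (everything else verbatim), modulo {Gross–Zagier, modularity}:
the missing binder is re-supplied by `nonTorsion_of_twistL_one_ne_zero`. Information for the prover (h₉ is decoration given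
h₃ ∧ h₇); no change of meaning. [folklore] -/
theorem noNonTorsion_of_wildSigmaDivisibilityAtThreeMultiCarrier
    (hGZ : ∀ (N : ℕ) [NeZero N] (W : WeierstrassCurve ℚ) (K : Type) [Field K] [NumberField K], gross_zagier N W K)
    (hmod : hasEntireLFunction_rat) (hJ : WildSigmaDivisibilityAtThreeMultiCarrier) :
    ∀ (W : WeierstrassCurve ℚ) [W.IsElliptic] [W.IsGloballyMinimal] (N : ℕ) [NeZero N] (K : Type)
      [Field K] [NumberField K] (Dt : ModularParametrizationData W N)
      (H : HeegnerDatum N (NumberField.discr K)) (ι : K →+* ℂ) (P : (W.baseChange K).toAffine.Point),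
      ClassO6 W 3 → W.HasSurjectiveModNGaloisRep 3 → W.analyticRank = 1 → W.conductorNorm ℤ = N →
      IsImaginaryQuadratic K → SatisfiesHeegnerHypothesis N K →
      (W.quadraticTwist (NumberField.discr K : ℚ)).entireLFunction 1 ≠ 0 →
      WeierstrassCurve.Affine.Point.map ι.toRatAlgHom P = heegnerPointComplex Dt H →
      Odd (NumberField.discr K) → NumberField.discr K ≠ -3 →
      (∀ (q : ℕ) [Fact q.Prime], q ∣ N →
        padicValNat 3 ((W.baseChange ℚ_[q]).localTamagawaNumber ℤ_[q]) <
          padicValNat 3 W.tamagawaProduct + padicValNat 3 Dt.c.natAbs) →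
      ∀ (s' : ℕ), s' ≤ padicValNat 3 W.tamagawaProduct + padicValNat 3 Dt.c.natAbs →
        ∀ (n : ℕ) (d : KolyvaginHeegnerData Dt H.β ι n), Squarefree n →
          (∀ ℓ ∈ n.primeFactors, Zhang2014.IsKolyvaginPrime N W K 3 ℓ ∧ s' ≤ Zhang2014.kolyvaginIndex W 3 ℓ) →
          Koly.PDiv d 3 s' := by
  intro W _ _ N _ K _ _ Dt H ι P hO6 hsurj hr hN hK hHH hLd hP hodd h3 hcut
  exact hJ W N K Dt H ι P hO6 hsurj hr hN hK hHH hLd hP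
    (nonTorsion_of_twistL_one_ne_zero (hGZ N W K) hmod Dt H ι P hr hK hHH hP hLd) hodd h3 hcut

end Summit.BirchSwinnertonDyer.BirchSwinnertonDyer.Theorems.WildSigmaDivisibilityAtThreeMultiCarrier.Negative
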